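import Mathlib.NumberTheory.LSeries.DirichletContinuation
import Mathlib.NumberTheory.ArithmeticFunction.Moebius
import Mathlib.NumberTheory.DirichletCharacter.Orthogonality
import Mathlib.Algebra.Polynomial.Degree.Defs
import HarnessLib

/-!
# The fourth moment of Dirichlet `L`-functions to ONE PRIME modulus: the power-saving records
# (Young 2011, Theorem 1.1; Blomer–Fouvry–Kowalski–Michel–Milićević 2017, Theorem 1.5;
# Zacharias 2019, Theorem 1.2 — the mollified fourth moment; Blomer–Humphries–Khan–Milinovich
# 2020, Theorem 4 — the sharp upper bound for the fourth moment twisted by `|Σ_{m≤M} a(m)χ(m)|²`,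
# `M ≤ q^{1/4}`)

Topic `Literature/NumberTheory/LFunctions` (namespace `Literature.NumberTheory.LFunctions`,
sub-namespace `FourthMomentPrimeModulus`). STATEMENT LAYER (D-0014: sorry-free named `Prop`
facts; nothing asserted) typed for the cell `landau-siegel` (LANDAU–SIEGEL PROGRAMME, rung F-S3,
sub-cell C literature harvest, rows r8-T21 / r8-T27 of `lit/r8/ROWS.md`): the printed records of
the OFF-DIAGONAL technology for a degree-`2 ⊗ 2` (fourth-moment) family of Dirichlet characters
to a SINGLE PRIME modulus — the power saving in the asymptotic, and the mollifier LENGTH that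
saving buys. They are the exchange-rate data against which that cell prices a hypothetical
length lever (`E*-len`) for designs with a degree-`≥ 4` numerator at one modulus; none of them is
a statement about Zhang's manuscript arXiv:2211.02515 or about Siegel zeros.

## What the sources print (held texts read 2026-08-26)

* M. P. Young, *The fourth moment of Dirichlet `L`-functions*, Ann. of Math. **173** (2011) 1–50 =
  arXiv:math/0610335, §1 p. 3 (arXiv), **Theorem 1.1**: "For prime `q ≠ 2`, we have
  `(1/φ*(q)) Σ*_{χ (mod q)} |L(1/2, χ)|⁴ = Σ_{i=0}^{4} c_i (log q)^i + O(q^{−5/512+ε})`,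
  for certain computable absolute constants `c_i`. Here `−5/512 = −1/80 + θ/40`, where `θ = 7/64`
  is the current best-known bound on the size of the Hecke eigenvalue `λ(n)` of a Maass form",
  "`φ*(q)` is the number of primitive characters modulo `q` … and the sum is over all primitive
  characters modulo `q`". [Young2011, Thm 1.1]
* V. Blomer, É. Fouvry, E. Kowalski, Ph. Michel, D. Milićević, *Some applications of smooth
  bilinear forms with Kloosterman sums*, Proc. Steklov Inst. Math. **296** (2017) 18–29 =
  arXiv:1604.07664, §1 **Theorem 1.5**: "There exists a polynomial `P₄ ∈ ℝ[X]` of degree `4`, such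
  that `(1/(q−1)) Σ_{χ (mod q)} |L(χ,1/2)|⁴ = P₄(log q) + O(q^{−η+ε})` for all primes `q`, where
  the implied constant depends only on `ε > 0`. If the Ramanujan–Petersson conjecture holds for
  Fourier coefficients of Hecke–Maaß forms of level `1`, then the exponent `η` can be replaced by
  `1/16`." The unconditional value of the macro `η` is fixed by §4 of the source: the two final
  conditions are "`−1/8 + (3/2)η ≤ −η`" and "`−1/8 + (5/4)η ≤ −η`", i.e. `η = 1/20`
  (`bfkmm_eta_conditions` below); Remark 1.6: "In [BFKMM, Amer. J. Math. 2017] the exponents were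
  respectively `1/32` (unconditionally) and `1/24` (assuming the Ramanujan–Petersson conjecture).
  The first breakthrough … is due to M. Young who obtained … `5/512` (resp. `1/80`)."
  [BlomerFouvryKowalskiMichelMilicevic2017Steklov, Thm 1.5, Rem 1.6, §4]
* R. Zacharias, *Mollification of the fourth moment of Dirichlet `L`-functions*, Acta Arith.
  **191** (2019) 201–257 = arXiv:1611.09582, §1.2 p. 5: "let `L = q^λ` with `λ > 0`, `(a_ℓ)_ℓ` a
  sequence of complex numbers, `P(X) ∈ ℂ[X]` and `χ` a character modulo `q`. We introduce the
  mollifier `M(χ) := Σ_{ℓ ≤ L} a_ℓ χ(ℓ) ℓ^{−1/2} P(log(L/ℓ)/log L)` and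
  `𝓜⁴(q) := (1/φ*(q)) Σ*_{χ (mod q)} |L(χ,1/2)|⁴ |M(χ)|⁴`." **Theorem 1.2**: "Set `a_ℓ = μ(ℓ)` and
  `P(X) = X²`. Then for any `0 < λ < 11/8064`, we have the asymptotic formula
  `𝓜⁴(q) = Σ_{i=0}^{4} a_i λ^{−i} + O_λ(1/log q)`, for some computable coefficients `a_i ∈ ℝ`."
  (`q > 2` prime throughout §1; `Σ*` "means that we avoid `χ = 1`, `φ*(q) = q − 2` is the number of
  primitive characters modulo `q`".) Theorem 1.1 of that paper (the twisted fourth moment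
  `𝒯⁴(ℓ₁,ℓ₂;q)` with error `O((ℓ₁ℓ₂)^{3/2} L⁵ q^{−η+ε})`, `η = 1/14 − 3θ/7`) has main terms given
  only by reference to interior formulas and is NOT typed; its exponent arithmetic is recorded in
  `zacharias_eta_eq`. [Zacharias2019, §1.2, Thm 1.2]
* V. Blomer, P. Humphries, R. Khan, M. B. Milinovich, *Motohashi's fourth moment identity for
  non-archimedean test functions and applications*, Compositio Math. **156** (2020) 1004–1038 =
  arXiv:1902.07042, §1.3 (held text p0005:L25–L34; the arXiv e-print TeX `motohashi-final4.tex`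
  l.192–194 read 2026-08-26 to restore the symbols the held extraction drops — the index `χ (mod q)`
  under the sum and `χ(m)`, `χ` in the summand), **Theorem 4**: "Let `q` be a prime,
  `1 ≤ M ≤ q^{1/4}`, and `{a(m)}_{1 ≤ m ≤ M}` a sequence of complex numbers supported on squarefree
  numbers. Then `Σ_{χ (mod q)} |Σ_{m ≤ M} a(m) χ(m)|² |L(1/2, χ)|⁴ ≪_ε ‖a‖_∞ (Mq)^{1+ε}`."  The sum is
  over ALL characters mod `q` (no `*`/primitivity mark, as in the paper's Theorem 1, which carries
  correction terms for the non-primitive character).  The factor `‖a‖_∞` is printed to the power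
  ONE; since the left-hand side is homogeneous of degree two in `a`, that literal reading is false
  by scaling, and the proof (§9, TeX l.1179: "Let us also assume without loss of generality that
  `‖a‖_∞ ≤ 1`") establishes the normalised statement; Gao–Wu–Zhao (arXiv:2509.24690, p. 4) restate
  the bound with `‖α‖²_∞`.  [BlomerHumphriesKhanMilinovich2020, Thm 4, §9]

## Lean rendering / design choices

* `L(χ, s)` = Mathlib's `DirichletCharacter.LFunction χ s` (the analytically continued function;
  for the trivial character mod `q` it is `ζ(s) ∏_{p|q}(1 − p^{−s})`, finite at `s = 1/2`).
* "primitive characters mod `q`" = `χ.IsPrimitive` (for `q` prime: all `χ ≠ 1`); `φ*(q)` = the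
  cardinality of that finset (we do not hard-code `q − 2`). BFKMM's Theorem 1.5 averages over ALL
  `q − 1` characters including the trivial one, exactly as printed (`allFourthMoment`).
* "`ℓ ≤ L`", `L = q^λ` real: `1 ≤ ℓ ≤ ⌊q^λ⌋₊`; `log(L/ℓ)/log L` with `L = q^λ` as a real number.
* `≪`/`O`-conventions: Young's `c_i` are ABSOLUTE ("computable absolute constants"), so they are
  bound before `ε`; the `O`-constant may depend on `ε` (resp. on `λ` in Zacharias). "For prime
  `q ≠ 2`" / "for all primes `q`" / "`q > 2` prime" verbatim; no large-`q` threshold is printed and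
  none is added (a threshold would only weaken the facts).
* Degree "`4`" of `P₄` is rendered as `P.natDegree = 4`.
* BHKM Theorem 4 is typed in the form the proof proves (the documented, sourced repair of the
  `‖a‖_∞`-power misprint): for `‖a‖_∞ ≤ 1` the twisted moment is `≤ C(ε)(Mq)^{1+ε}`
  (`bhkm2020_theorem4`); the homogeneous `‖a‖²_∞`-form is then DERIVED (`bhkm2020_theorem4.homogeneous`,
  proved by scaling).  `M : ℕ` with `1 ≤ M ≤ q^{1/4}` (the sequence is indexed by `1 ≤ m ≤ M`);
  "supported on squarefree numbers" = `a(m) = 0` unless `Squarefree m`; the Dirichlet polynomial is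
  `Σ_{1 ≤ m ≤ M} a(m) χ(m)` with `χ` evaluated on `m mod q`; the character sum is over ALL
  `χ mod q` (`twistedAllFourthMoment`), `L(1/2, χ)` Mathlib's `LFunction` as above.

PROVED here (bookkeeping only): `young_exponent_eq` (`−5/512 = −1/80 + (7/64)/40`),
`bfkmm_eta_conditions` (`η = 1/20` is the largest `η` with `−1/8 + (3/2)η ≤ −η`, and it also
satisfies `−1/8 + (5/4)η ≤ −η`), `zacharias_eta_eq` (`1/14 − 3·(7/64)/7 = 11/448`) and
`zacharias_length_lt_eta` (`11/8064 < 11/448`: the mollifier exponent is `1/18` of the saving),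
`twistedAllFourthMoment_smul` (homogeneity of degree two in `a`) and `bhkm2020_theorem4.homogeneous`
(the `‖a‖²_∞`-form from the normalised fact).  Nothing else is claimed.

## References

* [Young2011] Theorem 1.1 (arXiv:math/0610335 §1).
* [BlomerFouvryKowalskiMichelMilicevic2017Steklov] Theorem 1.5, Remark 1.6, §4 (arXiv:1604.07664).
* [Zacharias2019] §1.2 and Theorem 1.2 (arXiv:1611.09582).
* [BlomerHumphriesKhanMilinovich2020] §1.3 Theorem 4 and §9 (arXiv:1902.07042; TeX l.187–195,
  l.1179).
-/

noncomputable section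

open Finset

namespace Literature.NumberTheory.LFunctions

namespace FourthMomentPrimeModulus

open scoped Classical in
/-- `φ*(q)`: the number of primitive Dirichlet characters mod `q` (`= q − 2` for `q` prime).
[cite: Young2011, Thm 1.1] -/
def primitiveCount (q : ℕ) : ℕ :=
  (univ.filter fun χ : DirichletCharacter ℂ q => χ.IsPrimitive).card

open scoped Classical in
/-- The fourth moment over PRIMITIVE characters mod `q`:
`(1/φ*(q)) Σ*_{χ (mod q)} |L(1/2, χ)|⁴`. [cite: Young2011, Thm 1.1] -/
def primitiveFourthMoment (q : ℕ) [NeZero q] : ℝ :=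
  (∑ χ : DirichletCharacter ℂ q with χ.IsPrimitive, ‖χ.LFunction (1 / 2)‖ ^ 4) /
    (primitiveCount q : ℝ)

/-- The fourth moment over ALL `q − 1` characters mod a prime `q` (trivial character included),
`(1/(q−1)) Σ_{χ (mod q)} |L(χ, 1/2)|⁴`, as in Blomer–Fouvry–Kowalski–Michel–Milićević.
[cite: BlomerFouvryKowalskiMichelMilicevic2017Steklov, Thm 1.5] -/
def allFourthMoment (q : ℕ) [NeZero q] : ℝ :=
  (∑ χ : DirichletCharacter ℂ q, ‖χ.LFunction (1 / 2)‖ ^ 4) / ((q : ℝ) - 1)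

/-- Zacharias' mollifier with `a_ℓ = μ(ℓ)`, `P(X) = X²`, length `L = q^λ`:
`M(χ) = Σ_{ℓ ≤ L} μ(ℓ) χ(ℓ) ℓ^{−1/2} (log(L/ℓ)/log L)²`. [cite: Zacharias2019, §1.2 and Thm 1.2] -/
def mollifier (q : ℕ) (lam : ℝ) (χ : DirichletCharacter ℂ q) : ℂ :=
  ∑ ℓ ∈ Icc 1 ⌊(q : ℝ) ^ lam⌋₊,
    ((ArithmeticFunction.moebius ℓ : ℤ) : ℂ) * χ (ℓ : ZMod q) / ((Real.sqrt ℓ : ℝ) : ℂ) *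
      (((Real.log ((q : ℝ) ^ lam / ℓ) / Real.log ((q : ℝ) ^ lam)) ^ 2 : ℝ) : ℂ)

open scoped Classical in
/-- The mollified fourth moment `𝓜⁴(q) = (1/φ*(q)) Σ*_{χ (mod q)} |L(χ,1/2)|⁴ |M(χ)|⁴`
(`Σ*` over primitive characters). [cite: Zacharias2019, §1.2] -/
def mollifiedFourthMoment (q : ℕ) [NeZero q] (lam : ℝ) : ℝ :=
  (∑ χ : DirichletCharacter ℂ q with χ.IsPrimitive,
      ‖χ.LFunction (1 / 2)‖ ^ 4 * ‖mollifier q lam χ‖ ^ 4) /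
    (primitiveCount q : ℝ)

end FourthMomentPrimeModulus

open FourthMomentPrimeModulus

/-- **Young 2011, Theorem 1.1** (as printed, arXiv:math/0610335 §1): "For prime `q ≠ 2`, we have
`(1/φ*(q)) Σ*_{χ (mod q)} |L(1/2,χ)|⁴ = Σ_{i=0}^{4} c_i (log q)^i + O(q^{−5/512+ε})`, for certain
computable absolute constants `c_i`." The `c_i` are absolute (bound before `ε`); the `O`-constant
depends on `ε` only. Named fact, not proved here. [cite: Young2011, Thm 1.1] -/
def young2011_theorem11 : Prop :=
  ∃ c : Fin 5 → ℝ, ∀ ε : ℝ, 0 < ε → ∃ C : ℝ, ∀ (q : ℕ) [NeZero q], q.Prime → q ≠ 2 →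
    |primitiveFourthMoment q - ∑ i : Fin 5, c i * Real.log q ^ (i : ℕ)| ≤
      C * (q : ℝ) ^ (-(5 : ℝ) / 512 + ε)

/-- **Blomer–Fouvry–Kowalski–Michel–Milićević 2017 (Steklov), Theorem 1.5** (as printed,
arXiv:1604.07664 §1, with the unconditional exponent `η = 1/20` fixed by §4): "There exists a
polynomial `P₄ ∈ ℝ[X]` of degree `4`, such that `(1/(q−1)) Σ_{χ (mod q)} |L(χ,1/2)|⁴ = P₄(log q) +
O(q^{−1/20+ε})` for all primes `q`, where the implied constant depends only on `ε > 0`." (Under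
the Ramanujan–Petersson bound for level-`1` Hecke–Maaß forms the source replaces `1/20` by `1/16`;
that conditional clause is not typed — only the UNCONDITIONAL theorem is.) A theorem in print;
named fact, not proved here.
[cite: BlomerFouvryKowalskiMichelMilicevic2017Steklov, Thm 1.5] -/
def bfkmm2017_theorem15 : Prop :=
  ∃ P : Polynomial ℝ, P.natDegree = 4 ∧ ∀ ε : ℝ, 0 < ε → ∃ C : ℝ, ∀ (q : ℕ) [NeZero q], q.Prime →
    |allFourthMoment q - P.eval (Real.log q)| ≤ C * (q : ℝ) ^ (-(1 : ℝ) / 20 + ε)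

/-- **Zacharias 2019, Theorem 1.2** (as printed, arXiv:1611.09582 §1.2): "Set `a_ℓ = μ(ℓ)` and
`P(X) = X²`. Then for any `0 < λ < 11/8064`, we have the asymptotic formula
`𝓜⁴(q) = Σ_{i=0}^{4} a_i λ^{−i} + O_λ(1/log q)`, for some computable coefficients `a_i ∈ ℝ`"
(`q > 2` prime; `𝓜⁴(q)` the mollified fourth moment over primitive characters with the mollifier
of length `q^λ` above). The `a_i` do not depend on `λ`; the `O`-constant does. Named fact, not
proved here. [cite: Zacharias2019, Thm 1.2] -/
def zacharias2019_theorem12 : Prop :=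
  ∃ a : Fin 5 → ℝ, ∀ lam : ℝ, 0 < lam → lam < 11 / 8064 → ∃ C : ℝ, ∀ (q : ℕ) [NeZero q],
    q.Prime → 2 < q →
      |mollifiedFourthMoment q lam - ∑ i : Fin 5, a i * lam ^ (-(i : ℤ))| ≤ C / Real.log q

/-! ### Bookkeeping (proved): the printed exponent arithmetic -/

/-- Young's exponent: `−5/512 = −1/80 + θ/40` at `θ = 7/64`. [cite: Young2011, Thm 1.1] -/
theorem young_exponent_eq : (-(5 : ℝ) / 512) = -1 / 80 + (7 / 64) / 40 := by norm_num

/-- BFKMM §4: the unconditional exponent `η = 1/20` is exactly the largest `η` allowed by the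
first final condition `−1/8 + (3/2)η ≤ −η`, and it satisfies the second one `−1/8 + (5/4)η ≤ −η`.
[cite: BlomerFouvryKowalskiMichelMilicevic2017Steklov, §4] -/
theorem bfkmm_eta_conditions (η : ℝ) :
    (-1 / 8 + 3 / 2 * η ≤ -η ↔ η ≤ 1 / 20) ∧ (η = 1 / 20 → -1 / 8 + 5 / 4 * η ≤ -η) := by
  constructor
  · constructor <;> intro h <;> linarith
  · intro h; subst h; norm_num

/-- Zacharias' saving: `η = 1/14 − 3θ/7 = 11/448` at `θ = 7/64`. [cite: Zacharias2019, Thm 1.1] -/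
theorem zacharias_eta_eq : (1 : ℝ) / 14 - 3 * (7 / 64) / 7 = 11 / 448 := by norm_num

/-- The mollifier exponent `11/8064` of Theorem 1.2 is `η/18` with `η = 11/448`, in particular
`< η`. [cite: Zacharias2019, Thm 1.2] -/
theorem zacharias_length_lt_eta : (11 : ℝ) / 8064 = (11 / 448) / 18 ∧ (11 : ℝ) / 8064 < 11 / 448 := by
  constructor <;> norm_num

/-! ### Blomer–Humphries–Khan–Milinovich 2020, Theorem 4: the `|A|²`-twisted fourth moment,
### `A` of length `M ≤ q^{1/4}` (appended 2026-08-26, cell `landau-siegel` §C, HARVEST T-137) -/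

namespace FourthMomentPrimeModulus

/-- The Dirichlet polynomial `A(χ) = Σ_{1 ≤ m ≤ M} a(m) χ(m)` twisting the fourth moment in BHKM's
Theorem 4. [cite: BlomerHumphriesKhanMilinovich2020, Thm 4] -/
def charPoly (q : ℕ) (M : ℕ) (a : ℕ → ℂ) (χ : DirichletCharacter ℂ q) : ℂ :=
  ∑ m ∈ Icc 1 M, a m * χ (m : ZMod q)

/-- The twisted fourth moment over ALL characters mod `q`:
`Σ_{χ (mod q)} |Σ_{m ≤ M} a(m) χ(m)|² |L(1/2, χ)|⁴` (no normalisation, no primitivity restriction —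
as printed). [cite: BlomerHumphriesKhanMilinovich2020, Thm 4] -/
def twistedAllFourthMoment (q : ℕ) [NeZero q] (M : ℕ) (a : ℕ → ℂ) : ℝ :=
  ∑ χ : DirichletCharacter ℂ q, ‖charPoly q M a χ‖ ^ 2 * ‖χ.LFunction (1 / 2)‖ ^ 4

end FourthMomentPrimeModulus

/-- **Blomer–Humphries–Khan–Milinovich 2020, Theorem 4** (as printed, arXiv:1902.07042 §1.3):
"Let `q` be a prime, `1 ≤ M ≤ q^{1/4}`, and `{a(m)}_{1 ≤ m ≤ M}` a sequence of complex numbers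
supported on squarefree numbers. Then
`Σ_{χ (mod q)} |Σ_{m ≤ M} a(m) χ(m)|² |L(1/2, χ)|⁴ ≪_ε ‖a‖_∞ (Mq)^{1+ε}`."
Typed in the NORMALISED form the proof establishes (§9: "assume without loss of generality that
`‖a‖_∞ ≤ 1`"): for every `ε > 0` there is `C = C(ε)` such that for every prime `q`, every `M` with
`1 ≤ M ≤ q^{1/4}` and every `a` supported on squarefree numbers with `|a(m)| ≤ 1` for all `m`, the
twisted moment is `≤ C (Mq)^{1+ε}`.  (The printed right-hand side carries `‖a‖_∞` to the power one,
which cannot hold for all `a` by homogeneity; the `‖a‖²_∞`-form follows from this one by scaling —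
`bhkm2020_theorem4.homogeneous` — and is how Gao–Wu–Zhao 2025 restate the theorem.)  Implies
Burgess' bound `L(1/2,χ) ≪ q^{3/16+ε}` (source, sentence after the theorem).  Status:
theorem-in-print; named fact, not proved here.
[cite: BlomerHumphriesKhanMilinovich2020, Thm 4] -/
def bhkm2020_theorem4 : Prop :=
  ∀ ε : ℝ, 0 < ε → ∃ C : ℝ, ∀ (q : ℕ) [NeZero q], q.Prime → ∀ M : ℕ, 1 ≤ M →
    (M : ℝ) ≤ (q : ℝ) ^ (1 / 4 : ℝ) → ∀ a : ℕ → ℂ, (∀ m, ¬Squarefree m → a m = 0) →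
      (∀ m, ‖a m‖ ≤ 1) →
        twistedAllFourthMoment q M a ≤ C * ((M : ℝ) * q) ^ (1 + ε)

/-! ### Bookkeeping for Theorem 4 (proved): homogeneity and the `‖a‖²_∞`-form -/

/-- `A_{c·a}(χ) = c · A_a(χ)`. [cite: BlomerHumphriesKhanMilinovich2020, Thm 4] -/
theorem FourthMomentPrimeModulus.charPoly_smul (q M : ℕ) (a : ℕ → ℂ) (c : ℂ)
    (χ : DirichletCharacter ℂ q) : charPoly q M (fun m => c * a m) χ = c * charPoly q M a χ := by
  unfold charPoly
  rw [mul_sum]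
  exact sum_congr rfl fun m _ => by ring

/-- The twisted moment is homogeneous of degree two in the coefficients: scaling `a` by `c` scales it
by `|c|²`. [cite: BlomerHumphriesKhanMilinovich2020, Thm 4] -/
theorem FourthMomentPrimeModulus.twistedAllFourthMoment_smul (q : ℕ) [NeZero q] (M : ℕ)
    (a : ℕ → ℂ) (c : ℂ) :
    twistedAllFourthMoment q M (fun m => c * a m) = ‖c‖ ^ 2 * twistedAllFourthMoment q M a := by
  unfold twistedAllFourthMoment
  rw [mul_sum]
  refine sum_congr rfl fun χ _ => ?_
  rw [charPoly_smul, norm_mul, mul_pow, mul_assoc]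

/-- **The `‖a‖²_∞`-form of BHKM Theorem 4**, derived from the normalised named fact by scaling: for
every `ε > 0` there is `C` such that for `q` prime, `1 ≤ M ≤ q^{1/4}`, `a` supported on squarefree
numbers and ANY bound `|a(m)| ≤ A` (`m ≥ 0`),
`Σ_χ |Σ_{m≤M} a(m)χ(m)|² |L(1/2,χ)|⁴ ≤ C · A² · (Mq)^{1+ε}`.  This is the reading under which the printed
`‖a‖_∞`-display is a theorem (Gao–Wu–Zhao 2025 state it with `‖α‖²_∞`).
[cite: BlomerHumphriesKhanMilinovich2020, Thm 4, §9 (normalisation ‖a‖_∞ ≤ 1)] -/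
theorem bhkm2020_theorem4.homogeneous (h : bhkm2020_theorem4) :
    ∀ ε : ℝ, 0 < ε → ∃ C : ℝ, ∀ (q : ℕ) [NeZero q], q.Prime → ∀ M : ℕ, 1 ≤ M →
      (M : ℝ) ≤ (q : ℝ) ^ (1 / 4 : ℝ) → ∀ a : ℕ → ℂ, (∀ m, ¬Squarefree m → a m = 0) →
        ∀ A : ℝ, (∀ m, ‖a m‖ ≤ A) →
          twistedAllFourthMoment q M a ≤ C * A ^ 2 * ((M : ℝ) * q) ^ (1 + ε) := by
  intro ε hε
  obtain ⟨C, hC⟩ := h ε hε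
  refine ⟨max C 0, fun q _ hq M hM hMq a ha A hA => ?_⟩
  have hA0 : 0 ≤ A := (norm_nonneg _).trans (hA 0)
  have hpow : 0 ≤ ((M : ℝ) * q) ^ (1 + ε) := by positivity
  rcases hA0.eq_or_lt with hA0 | hApos
  · -- `A = 0`: all coefficients vanish and the moment is `0`.
    have ha0 : ∀ m, a m = 0 := fun m => norm_le_zero_iff.mp (hA0 ▸ hA m)
    have : twistedAllFourthMoment q M a = 0 := by
      unfold twistedAllFourthMoment charPoly
      simp [ha0]
    rw [this]
    exact mul_nonneg (mul_nonneg (le_max_right _ _) (sq_nonneg _)) hpow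
  · -- `A > 0`: apply the normalised fact to `a/A`.
    set b : ℕ → ℂ := fun m => (A : ℂ)⁻¹ * a m with hb
    have hb_sf : ∀ m, ¬Squarefree m → b m = 0 := fun m hm => by simp [hb, ha m hm]
    have hb_le : ∀ m, ‖b m‖ ≤ 1 := fun m => by
      rw [hb, norm_mul, norm_inv, Complex.norm_real, Real.norm_eq_abs, abs_of_pos hApos,
        inv_mul_le_iff₀ hApos, mul_one]
      exact hA m
    have key := hC q hq M hM hMq b hb_sf hb_le
    have hscale : twistedAllFourthMoment q M b = A⁻¹ ^ 2 * twistedAllFourthMoment q M a := by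
      rw [hb, twistedAllFourthMoment_smul, norm_inv, Complex.norm_real, Real.norm_eq_abs,
        abs_of_pos hApos]
    rw [hscale] at key
    have hA2 : 0 < A ^ 2 := by positivity
    calc twistedAllFourthMoment q M a
        = A ^ 2 * (A⁻¹ ^ 2 * twistedAllFourthMoment q M a) := by
          rw [← mul_assoc, ← mul_pow, mul_inv_cancel₀ hApos.ne', one_pow, one_mul]
      _ ≤ A ^ 2 * (C * ((M : ℝ) * q) ^ (1 + ε)) := mul_le_mul_of_nonneg_left key hA2.le
      _ ≤ A ^ 2 * (max C 0 * ((M : ℝ) * q) ^ (1 + ε)) :=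
          mul_le_mul_of_nonneg_left (mul_le_mul_of_nonneg_right (le_max_left _ _) hpow) hA2.le
      _ = max C 0 * A ^ 2 * ((M : ℝ) * q) ^ (1 + ε) := by ring

end Literature.NumberTheory.LFunctions

end
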